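import Literature.AnabelianGeometry.SemiGraphs.TemperedFunctorialityHomProofs
import Literature.AnabelianGeometry.SemiGraphs.TemperoidsHomEqResProofs
import HarnessLib

/-!
# Semi-graphs of anabelioids, §3, Proposition 3.6 (iv) — first clause of `InducedHomOfMorphism`, unconditionally

Mochizuki, *Semi-graphs of anabelioids*, Publ. RIMS **42** (2006), §3, Proposition 3.6 (iv)
(manuscript p. 39) [cite: MochizukiSemiAnbd2006, Prop 3.6(iv) p.39]: "Any morphism of semi-graphs
of anabelioids `G' → G` induces a morphism of temperoids `B^temp(G') → B^temp(G)`", hence — through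
charts and Proposition 3.2 — a continuous homomorphism `π₁^temp(G') → π₁^temp(G)` compatible, up to
conjugation, with the verticial homomorphisms.  abc-iut-L3-t10's `Hom.exists_inducedHom_of_eqRes`
(`TemperedFunctorialityHomProofs.lean`) proves exactly this REDUCED to the surjectivity half of
Proposition 3.2 (`TemperoidHomEqRes`); abc-iut-L3-d2's `TemperoidHomEqRes_holds`
(`TemperoidsHomEqResProofs.lean`) discharges that named fact.  This 3-line file composes the two:
the FIRST CLAUSE of abc-iut-L3-t2's named fact `InducedHomOfMorphism` (`TemperedVerticial.lean`),
for EVERY morphism `F : 𝒢' → 𝒢` and all charts (no `Prop36Hypotheses` needed for this clause).  The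
second clause (locally open ⇒ relatively temp-slim) is NOT treated here (L3-lead rulings χ/β2: it is
reduced separately modulo the printed infinite-index step, abc-iut-L3-t6).

Proof-only file (no definitions); assembled by abc-iut-L6-d4 under the L3 succession rule
(ROW «G10 RUNG 5 (b)»).  Nothing here takes a side on [IUTchIII] Cor. 3.12.
-/

namespace Literature.AnabelianGeometry.SemiGraphs

namespace ProfiniteSemiGraph

universe u

variable {𝒢' 𝒢 : ProfiniteSemiGraph.{u}}

/-- **[SemiAnbd] Proposition 3.6 (iv), first clause of `InducedHomOfMorphism`, UNCONDITIONAL**: for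
every morphism `F : 𝒢' → 𝒢` of (profinite) semi-graphs of anabelioids and all charts `c'`, `c` of the
tempered fundamental groups, there is a continuous homomorphism `φ : π₁^temp(𝒢') → π₁^temp(𝒢)` such
that for every vertex `v'`, every verticial homomorphism `ψ'` of `𝒢'` at `v'` and `ψ` of `𝒢` at
`F v'`, `φ ∘ ψ'` and `ψ ∘ F_{v'}` are conjugate in `π₁^temp(𝒢)`.  (`exists_inducedHom_of_eqRes` of
abc-iut-L3-t10 composed with abc-iut-L3-d2's `TemperoidHomEqRes_holds`.)
[cite: MochizukiSemiAnbd2006, Prop 3.6(iv) p.39] -/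
theorem Hom.InducedHomOfMorphism_clause1 (F : Hom 𝒢' 𝒢) (c' : TemperedPiChart 𝒢')
    (c : TemperedPiChart 𝒢) :
    ∃ φ : c'.G →ₜ* c.G,
      ∀ (v' : 𝒢'.graph.Vertex) (ψ' : 𝒢'.Gv v' →ₜ* c'.G)
        (ψ : 𝒢.Gv (F.base.vertexMap v') →ₜ* c.G),
        IsVerticialHom c' v' ψ' → IsVerticialHom c (F.base.vertexMap v') ψ →
          ∃ g : c.G, ∀ x, φ (ψ' x) = g * ψ (F.hV v' x) * g⁻¹ :=
  F.exists_inducedHom_of_eqRes c' c (TemperoidHomEqRes_holds c'.G c.G)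

end ProfiniteSemiGraph

end Literature.AnabelianGeometry.SemiGraphs
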